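import Summits.QuantumFields.YangMills.Theorems.BalabanUVNodesN11O3OfSplitChartsAtRecord13

/-!
# DAG node N11 — THE FIRST 𝐓-STEP's (O3′) CLAUSE FROM SPLIT FIBRE CHARTS AND THE SMALL-FIELD FLUCTUATION INTEGRAL PERFORMED POINTWISE IN THE KEPT VARIABLES
# ([I] Thm 1 + [II] displayed as: per frozen `y` a chart `(τ, Ψ, J, S)` of `U|_{B_0(Ω_1)}` with coordinates (kept `a` on `B_0(Ω_1 ∖ Λ_1)`, integrated `x`), `hpush`, `hsec`, support, ONE identity per `(v, a)`)

HEADER — WORK-UNIT METADATA.  Cell `pub-ymgap`, YM-PLAN Track A (D-0062), seat `pub-ymgap-dag-n11-d` (g17; N11 [B14], s2), route `BalabanUVNodes`, item K1⁹ = stmt-QuantumFields-27364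
(helper lane, `--kind proof --supports 27364 --as helper`, count-neutral).  [I] = [Balaban1987RG1], [II] = [Balaban1988RG2Cluster], [III] = [Balaban1988Convergent], [15] =
[Balaban1985Variational].  Composition BY NAME of this seat's g17 `…N11FibrewiseIdentityOfFibreChart` (`condExp_identity_of_fibreCharts_of_nonneg`, a `y`-parametrised chart family)
and `…N11ChartReadingOfKeptSplit` (`reading_of_keptSplit_at_record`: the reading from (3.23) pointwise in the kept variables) with p639540 ∕ p640513 (the (O3′) clause from (hce₀));
row discharges VERBATIM as in p646357 (+ `measurable_tkWeightsOfRecordP_ζ ∕ _w` for the new weights, `Measure.compProd_const`, `Kernel.const_apply`).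

WHY THIS FILE.  After this seat's g16–g17 files the (O3′) debt of a §3 supplier is, per 𝐓-present child `s′`, old branch `S₀` and a.e. frozen retained configuration `y`,
ONE fibrewise identity; print proves it by a chart of the inside variables whose coordinates are the new fluctuation field `A` on `B(Ω_{k+1})` = (KEPT `a` on `Ω_{k+1} ∖ Λ_{k+1}`,
which 11a's generation `𝐓^{(k)}` integrates later with the A-weight `χ·e^{−½⟨a,𝒬a⟩}`) × (INTEGRATED `x` on `Λ_{k+1}`), and by PERFORMING the `x`-integral at fixed `a`
([III] (3.16)–(3.23), Thm 2's re-expansion; [I] Thm 1 + [II] at the first step).  THIS FILE states the (O3′) clause with exactly that burden displayed and NOTHING ELSE analytic: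
per `(s′, S₀)` and a.e. `y` SEPARATELY — `Ψ`, `J` measurable; `hpush` for `dv ⊗ (da ⊗ τ)`; `hsec`; the support clause; and (hpt) «for a.e. `(v, a)`:
∫ J(v,a,x)·piece_{S₀}(e⁻¹(y,Ψ(v,a,x))) dτ(x) = ζ_k(Ω^c_{k+1})(ω_{y,v}) · Σ_Y w_k(Λ_{k+1}, Λ^c_{k+1}∩Ω_{k+1}, Y)(ω^a_{y,v}) · (𝐓_k(init s′,S₀)[W′] e^{A_{k+1}(s′,S₀∪Y)})(ω^a_{y,v})».

WHAT THIS FILE PROVES (0 `def`, 0 `sorry`, standard axioms).  ★★★ `slotsTOfRecord₁₃H_one_O3_of_splitChartsRho_of_provisos` (the first 𝐓-step, old piece `w(s′)·ρ₀`, old branch `∅`;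
the all-levels edition is `…N11O3OfSplitChartsAtRecord13`).

HONEST FRAMING.  Helper lane of K1⁹; count-neutral; compositions BY NAME; the split charts, `hpush`, `hsec`, the support clause and (hpt) are HYPOTHESES — (hpt) IS [III]
(3.16)–(3.23) ∘ Thm 2 ([I] Thm 1 + [II] at the first step), the charts ARE [I] §2 + [15] Sect. C — NOT proved; NO chart constructed, NO Jacobian computed, NO Gaussian integration
performed; nothing of Bałaban asserted; N11 NOT discharged; K1⁹ NOT closed, no registered stub touched; counts unmoved (typed 28∕28 · discharged 5∕27 · A 5∕28).  One finite
`𝕋⁴_{L^K}` programme at fixed `ε = L^{−K}` — NOT ℝ⁴, NOT OS, NOT a mass gap, NOT Clay.  No `sorry`, `axiom`, `def`, `instance`, `notation`.  Sources (SHAPE only): [III] Thm 1 p.262,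
Thm 2 p.263, (2.18) p.257, (2.20)–(2.21) p.258, (3.1) p.264, (3.10)–(3.11) p.266, (3.12)–(3.14) p.267, (3.16)–(3.25) pp.268–270, §3 p.279; [I] Thm 1 p.258, (0.4) p.253, §2 p.267; [15] (47)–(49) pp.287–288.
-/

noncomputable section

open MeasureTheory ProbabilityTheory
open scoped ENNReal NNReal BigOperators Matrix.Norms.L2Operator

namespace Summit.QuantumFields.YangMills.Theorems.BalabanUVNodesN11FirstTStepO3OfSplitCharts

open Literature.MathematicalPhysics.QuantumFieldTheory.Balaban1983to89
open Literature.MathematicalPhysics.QuantumFieldTheory.Balaban1983to89.T4AveragingDisintegration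
open BalabanUVNodesN11FibrewiseIdentityOfFibreChart (condExp_identity_of_fibreCharts_of_nonneg)
open BalabanUVNodesN11ChartReadingOfKeptSplit (reading_of_keptSplit_at_record)
open BalabanUVNodesN11TkOpMeasurable (measurable_tkWeightsOfRecordP_ζ measurable_tkWeightsOfRecordP_w)
open T4AdjointCovariance (insA)
open BalabanUVNodesN11O3OfIntrinsicReading (measurable_intrinsicReading_of_hgm)
open BalabanUVNodesN11O3OfIntrinsicReadingAtRecord13 (slotsTOfRecord₁₃H_succ_O3_of_hasSect2FormAtZS_of_oldBranchCondExp_of_provisos)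
open BalabanUVNodesN11FirstTStepO3OfIntrinsicReading (slotsTOfRecord₁₃H_one_O3_of_condExpRho_of_provisos)
open BalabanUVNodesN11TStepGraphIntegrableOfProvisos (hG_at_record₁₃_of_provisos)
open BalabanUVNodesN11TStepOldBranchGraphIntegrable (integrable_oldBranch_pieces₁₃H_of_integrable_graph tkBranchOfRecord_nonneg)
open BalabanUVNodesN11TStepBranchSumAtRecord13OfLaws (hgm_at_record₁₃_of_rows)
open N21StepWeightsPositivity (zetaOfRecord_nonneg)
open Literature.MathematicalPhysics.QuantumFieldTheory.Balaban1983to89.B14SeparationOfRecord (slotsTOfRecord_succ_eq_zero_of_init_eq_zero)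
open Node00 hiding SU
open Node00.Tk T4Continuum B14.Eq218Concrete
open B10Eq42TorusConstraint (bondsIn)

variable {F : T4Family} {N : ℕ} [NeZero N]

/-! ## The first 𝐓-step: split charts and the pointwise identity with the old piece `w(s′)·ρ₀` -/

section FirstStep

/-- ★★★ **THE FIRST 𝐓-STEP's (O3′) DISJUNCTION FROM SPLIT FIBRE CHARTS AND (3.23) POINTWISE IN THE KEPT VARIABLES** (old piece `w(s′)·ρ₀`, old branch `∅`, Theorem 1's
base form discharged): p646357 §3 with the weak identity produced from the charts and the pointwise identity — [I] Thm 1 + [II] as: a chart per frozen `y`, and per `(v, a)`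
«the small-field fluctuation integral over `Λ_1` performed» — for a.e. frozen `y = U|_{B_0(Ω^c_1)}` and every bounded measurable `h` of `V|_{B_1(Ω_1)}`:
`∫ w(s′)(U,Ū)·ρ₀(U)·h(Ū|_{B_1(Ω_1)}) dU|_{B_0(Ω_1)} = ∫ R̃_∅(y,v₂)·h(v₂) dv₂` at `U = e⁻¹(y,u)` — [I] Thm 1 + [II] read FIBREWISE: the old variables off the large-field region frozen, the
small-field variables integrated against the averaging constraint. [cite: Balaban1988Convergent, Thm 1 p.262, (3.1) p.264, (3.23)–(3.25) p.270; Balaban1987RG1, Thm 1 p.258, §2 p.267] -/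
theorem slotsTOfRecord₁₃H_one_O3_of_splitChartsRho_of_provisos (θ : Stage13HParams F N) (h : θ.Provisos₁₃CoPH F N) (p : B12.RunParams) (hK : 0 < p.K)
    {hdec : DecidableEq (PBond (F.P p.K) 0)} {hdec' : DecidableEq (PBond (F.P p.K) 1)}
    (s' : SeqOfRecord F θ.ν θ.τ9.M (gOfRecord₁₃ F N θ.toStage13Params p) p.K 1)
    (u₁ : Sect2.TermValues (F.P p.K) (MatA N) (FluctV N) θ.τ9.M) (e₁ : ℝ)
    (hζ0m : ∀ j Y, Measurable ((θ.zhAt p s'.init).ζ0 j Y)) (hqm : ∀ j Λ', Measurable ((θ.zhAt p s'.init).quad j Λ'))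
    (hζm : ∀ j Y, Measurable ((θ.zhAt p s').ζ0 j Y)) (hqm' : ∀ j Λ', Measurable ((θ.zhAt p s').quad j Λ'))
    (hΦm : ∀ S ∈ admSOfRecord F θ.ν θ.τ9.M (gOfRecord₁₃ F N θ.toStage13Params p) p.K 1 s',
      Measurable fun ω : MultiCfg (F.P p.K) (SU N) (FluctV N) =>
        (sect2Operand F N (FluctV N) p.K (settingOfRecord₁₃ F N θ.toStage13Params p) (θ.rzAt p s') s' u₁ e₁
                  (UbgOfRecord₁₃CoP F N θ.toStage13Params p 1 s')) (S, fun j => (ω j).2) (fun j => (ω j).1))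
    {X : Type*} [MeasurableSpace X]
    (τ : (↥(Set.toFinite (bondsIn 0 (s'.Ω 1)ᶜ)).toFinset → SU N) → Measure X) [hτ : ∀ y, SFinite (τ y)]
    (Ψ : (↥(Set.toFinite (bondsIn 0 (s'.Ω 1)ᶜ)).toFinset → SU N) → ({c : PBond (F.P p.K) 1 // c ∉ (Set.toFinite (bondsIn 1 (s'.Ω 1)ᶜ)).toFinset} → SU N) × ((↥(Set.toFinite (bondsIn 0 ((s'.Λ 1)ᶜ ∩ s'.Ω 1))).toFinset → FluctV N) × X) → ({b : PBond (F.P p.K) 0 // b ∉ (Set.toFinite (bondsIn 0 (s'.Ω 1)ᶜ)).toFinset} → SU N))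
    (J : (↥(Set.toFinite (bondsIn 0 (s'.Ω 1)ᶜ)).toFinset → SU N) → ({c : PBond (F.P p.K) 1 // c ∉ (Set.toFinite (bondsIn 1 (s'.Ω 1)ᶜ)).toFinset} → SU N) × ((↥(Set.toFinite (bondsIn 0 ((s'.Λ 1)ᶜ ∩ s'.Ω 1))).toFinset → FluctV N) × X) → ℝ≥0)
    (Sc : (↥(Set.toFinite (bondsIn 0 (s'.Ω 1)ᶜ)).toFinset → SU N) → Set ({b : PBond (F.P p.K) 0 // b ∉ (Set.toFinite (bondsIn 0 (s'.Ω 1)ᶜ)).toFinset} → SU N))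
    -- PER FROZEN `y`: A SPLIT CHART (kept `a` ∕ integrated `x`), ITS SUPPORT CLAUSE, AND (3.23) POINTWISE IN `(v, a)` — nothing asked in `y`
    (hsplit : ∀ᵐ y ∂(Measure.pi fun _ : ↥(Set.toFinite (bondsIn 0 (s'.Ω 1)ᶜ)).toFinset => (HaarData.haar : Measure (SU N))),
      Measurable (Ψ y) ∧ Measurable (J y) ∧
      (((Measure.pi fun _ : {c : PBond (F.P p.K) 1 // c ∉ (Set.toFinite (bondsIn 1 (s'.Ω 1)ᶜ)).toFinset} => (HaarData.haar : Measure (SU N))).prod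
          ((Measure.pi fun _ : ↥(Set.toFinite (bondsIn 0 ((s'.Λ 1)ᶜ ∩ s'.Ω 1))).toFinset => (volume : Measure (FluctV N))).prod (τ y))).withDensity
          (fun z => (J y z : ℝ≥0∞))).map (Ψ y) =
        (Measure.pi fun _ : {b : PBond (F.P p.K) 0 // b ∉ (Set.toFinite (bondsIn 0 (s'.Ω 1)ᶜ)).toFinset} => (HaarData.haar : Measure (SU N))).restrict (Sc y) ∧
      (∀ᵐ z ∂(((Measure.pi fun _ : {c : PBond (F.P p.K) 1 // c ∉ (Set.toFinite (bondsIn 1 (s'.Ω 1)ᶜ)).toFinset} => (HaarData.haar : Measure (SU N))).prod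
          ((Measure.pi fun _ : ↥(Set.toFinite (bondsIn 0 ((s'.Λ 1)ᶜ ∩ s'.Ω 1))).toFinset => (volume : Measure (FluctV N))).prod (τ y))).withDensity
          (fun z => (J y z : ℝ≥0∞))),
        (fun c : {c : PBond (F.P p.K) 1 // c ∉ (Set.toFinite (bondsIn 1 (s'.Ω 1)ᶜ)).toFinset} =>
          (avOfRecord F N p.K 0).avg ((MeasurableEquiv.piEquivPiSubtypeProd (fun _ : PBond (F.P p.K) 0 => SU N)
              (· ∈ (Set.toFinite (bondsIn 0 (s'.Ω 1)ᶜ)).toFinset)).symm (y, Ψ y z)) c) = z.1) ∧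
      (∀ u, u ∉ Sc y → (fun U => wOfRecord₉ F N θ.toStage9Params p (gOfRecord₁₃ F N θ.toStage13Params p) 0 s' U ((avOfRecord F N p.K 0).avg U) *
            slotsOfRecord F N θ.ν θ.τ9 (EOfRecord₁₃ F N θ.toStage13Params) (wOfRecord₉ F N θ.toStage9Params) θ.ppSel p (gOfRecord₁₃ F N θ.toStage13Params p) 0 s'.init U)
          ((MeasurableEquiv.piEquivPiSubtypeProd (fun _ : PBond (F.P p.K) 0 => SU N)
              (· ∈ (Set.toFinite (bondsIn 0 (s'.Ω 1)ᶜ)).toFinset)).symm (y, u)) = 0) ∧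
      (∀ᵐ q ∂((Measure.pi fun _ : {c : PBond (F.P p.K) 1 // c ∉ (Set.toFinite (bondsIn 1 (s'.Ω 1)ᶜ)).toFinset} => (HaarData.haar : Measure (SU N))).prod
          (Measure.pi fun _ : ↥(Set.toFinite (bondsIn 0 ((s'.Λ 1)ᶜ ∩ s'.Ω 1))).toFinset => (volume : Measure (FluctV N)))),
        ∫ x, (J y (q.1, (q.2, x)) : ℝ) * (fun U => wOfRecord₉ F N θ.toStage9Params p (gOfRecord₁₃ F N θ.toStage13Params p) 0 s' U ((avOfRecord F N p.K 0).avg U) *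
            slotsOfRecord F N θ.ν θ.τ9 (EOfRecord₁₃ F N θ.toStage13Params) (wOfRecord₉ F N θ.toStage9Params) θ.ppSel p (gOfRecord₁₃ F N θ.toStage13Params p) 0 s'.init U)
          ((MeasurableEquiv.piEquivPiSubtypeProd (fun _ : PBond (F.P p.K) 0 => SU N)
              (· ∈ (Set.toFinite (bondsIn 0 (s'.Ω 1)ᶜ)).toFinset)).symm (y, Ψ y (q.1, (q.2, x)))) ∂(τ y) =
        (WtOfRecord₁₃H F N θ p s').ζ 0 (s'.Ω 1)ᶜ
          (Function.update (baseCfg 1 ((MeasurableEquiv.piEquivPiSubtypeProd (fun _ : PBond (F.P p.K) 1 => SU N)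
              (· ∈ (Set.toFinite (bondsIn 1 (s'.Ω 1)ᶜ)).toFinset)).symm (avgRestrOfRecord F N p.K 0 (Set.toFinite (bondsIn 0 (s'.Ω 1)ᶜ)).toFinset
                (Set.toFinite (bondsIn 1 (s'.Ω 1)ᶜ)).toFinset y, q.1))) 0
            (Function.updateFinset ((baseCfg (V := FluctV N) 1 ((MeasurableEquiv.piEquivPiSubtypeProd (fun _ : PBond (F.P p.K) 1 => SU N)
              (· ∈ (Set.toFinite (bondsIn 1 (s'.Ω 1)ᶜ)).toFinset)).symm (avgRestrOfRecord F N p.K 0 (Set.toFinite (bondsIn 0 (s'.Ω 1)ᶜ)).toFinset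
                (Set.toFinite (bondsIn 1 (s'.Ω 1)ᶜ)).toFinset y, q.1))) 0).1 (Set.toFinite (bondsIn 0 (s'.Ω 1)ᶜ)).toFinset y,
              ((baseCfg (V := FluctV N) 1 ((MeasurableEquiv.piEquivPiSubtypeProd (fun _ : PBond (F.P p.K) 1 => SU N)
              (· ∈ (Set.toFinite (bondsIn 1 (s'.Ω 1)ᶜ)).toFinset)).symm (avgRestrOfRecord F N p.K 0 (Set.toFinite (bondsIn 0 (s'.Ω 1)ᶜ)).toFinset
                (Set.toFinite (bondsIn 1 (s'.Ω 1)ᶜ)).toFinset y, q.1))) 0).2)) *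
        ∑ Y ∈ (Set.toFinite {Y : Set (Site (F.P p.K) 0) | Y ∈ SClassOfRecord F θ.ν (gOfRecord₁₃ F N θ.toStage13Params p) p.K 1 ∧ Y ⊆ s'.Ω 1 ∩ (s'.Λ 1)ᶜ}).toFinset,
          ((genDataOfRecord F N (FluctV N) θ.ν θ.τ9.M (gOfRecord₁₃ F N θ.toStage13Params p) p.K (WtOfRecord₁₃H F N θ p s') s' (Function.update (fun _ => ∅) 1 Y) 0).w
            (Function.update (Function.update (baseCfg 1 ((MeasurableEquiv.piEquivPiSubtypeProd (fun _ : PBond (F.P p.K) 1 => SU N)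
              (· ∈ (Set.toFinite (bondsIn 1 (s'.Ω 1)ᶜ)).toFinset)).symm (avgRestrOfRecord F N p.K 0 (Set.toFinite (bondsIn 0 (s'.Ω 1)ᶜ)).toFinset
                (Set.toFinite (bondsIn 1 (s'.Ω 1)ᶜ)).toFinset y, q.1))) 0
            (Function.updateFinset ((baseCfg (V := FluctV N) 1 ((MeasurableEquiv.piEquivPiSubtypeProd (fun _ : PBond (F.P p.K) 1 => SU N)
              (· ∈ (Set.toFinite (bondsIn 1 (s'.Ω 1)ᶜ)).toFinset)).symm (avgRestrOfRecord F N p.K 0 (Set.toFinite (bondsIn 0 (s'.Ω 1)ᶜ)).toFinset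
                (Set.toFinite (bondsIn 1 (s'.Ω 1)ᶜ)).toFinset y, q.1))) 0).1 (Set.toFinite (bondsIn 0 (s'.Ω 1)ᶜ)).toFinset y,
              ((baseCfg (V := FluctV N) 1 ((MeasurableEquiv.piEquivPiSubtypeProd (fun _ : PBond (F.P p.K) 1 => SU N)
              (· ∈ (Set.toFinite (bondsIn 1 (s'.Ω 1)ᶜ)).toFinset)).symm (avgRestrOfRecord F N p.K 0 (Set.toFinite (bondsIn 0 (s'.Ω 1)ᶜ)).toFinset
                (Set.toFinite (bondsIn 1 (s'.Ω 1)ᶜ)).toFinset y, q.1))) 0).2)) 0 (insA (Set.toFinite (bondsIn 0 ((s'.Λ 1)ᶜ ∩ s'.Ω 1))).toFinset q.2 ((Function.update (baseCfg 1 ((MeasurableEquiv.piEquivPiSubtypeProd (fun _ : PBond (F.P p.K) 1 => SU N)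
              (· ∈ (Set.toFinite (bondsIn 1 (s'.Ω 1)ᶜ)).toFinset)).symm (avgRestrOfRecord F N p.K 0 (Set.toFinite (bondsIn 0 (s'.Ω 1)ᶜ)).toFinset
                (Set.toFinite (bondsIn 1 (s'.Ω 1)ᶜ)).toFinset y, q.1))) 0
            (Function.updateFinset ((baseCfg (V := FluctV N) 1 ((MeasurableEquiv.piEquivPiSubtypeProd (fun _ : PBond (F.P p.K) 1 => SU N)
              (· ∈ (Set.toFinite (bondsIn 1 (s'.Ω 1)ᶜ)).toFinset)).symm (avgRestrOfRecord F N p.K 0 (Set.toFinite (bondsIn 0 (s'.Ω 1)ᶜ)).toFinset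
                (Set.toFinite (bondsIn 1 (s'.Ω 1)ᶜ)).toFinset y, q.1))) 0).1 (Set.toFinite (bondsIn 0 (s'.Ω 1)ᶜ)).toFinset y,
              ((baseCfg (V := FluctV N) 1 ((MeasurableEquiv.piEquivPiSubtypeProd (fun _ : PBond (F.P p.K) 1 => SU N)
              (· ∈ (Set.toFinite (bondsIn 1 (s'.Ω 1)ᶜ)).toFinset)).symm (avgRestrOfRecord F N p.K 0 (Set.toFinite (bondsIn 0 (s'.Ω 1)ᶜ)).toFinset
                (Set.toFinite (bondsIn 1 (s'.Ω 1)ᶜ)).toFinset y, q.1))) 0).2)) 0))) *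
          (tkBranchOfRecord F N (FluctV N) θ.ν θ.τ9.M (gOfRecord₁₃ F N θ.toStage13Params p) p.K (WtOfRecord₁₃H F N θ p s') s'.init (fun _ => ∅) 0
                (fun ω => (sect2Operand F N (FluctV N) p.K (settingOfRecord₁₃ F N θ.toStage13Params p) (θ.rzAt p s') s' u₁ e₁
                  (UbgOfRecord₁₃CoP F N θ.toStage13Params p 1 s')) (Function.update (fun _ => ∅) 1 Y, fun j => (ω j).2) (fun j => (ω j).1)))
            (Function.update (Function.update (baseCfg 1 ((MeasurableEquiv.piEquivPiSubtypeProd (fun _ : PBond (F.P p.K) 1 => SU N)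
              (· ∈ (Set.toFinite (bondsIn 1 (s'.Ω 1)ᶜ)).toFinset)).symm (avgRestrOfRecord F N p.K 0 (Set.toFinite (bondsIn 0 (s'.Ω 1)ᶜ)).toFinset
                (Set.toFinite (bondsIn 1 (s'.Ω 1)ᶜ)).toFinset y, q.1))) 0
            (Function.updateFinset ((baseCfg (V := FluctV N) 1 ((MeasurableEquiv.piEquivPiSubtypeProd (fun _ : PBond (F.P p.K) 1 => SU N)
              (· ∈ (Set.toFinite (bondsIn 1 (s'.Ω 1)ᶜ)).toFinset)).symm (avgRestrOfRecord F N p.K 0 (Set.toFinite (bondsIn 0 (s'.Ω 1)ᶜ)).toFinset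
                (Set.toFinite (bondsIn 1 (s'.Ω 1)ᶜ)).toFinset y, q.1))) 0).1 (Set.toFinite (bondsIn 0 (s'.Ω 1)ᶜ)).toFinset y,
              ((baseCfg (V := FluctV N) 1 ((MeasurableEquiv.piEquivPiSubtypeProd (fun _ : PBond (F.P p.K) 1 => SU N)
              (· ∈ (Set.toFinite (bondsIn 1 (s'.Ω 1)ᶜ)).toFinset)).symm (avgRestrOfRecord F N p.K 0 (Set.toFinite (bondsIn 0 (s'.Ω 1)ᶜ)).toFinset
                (Set.toFinite (bondsIn 1 (s'.Ω 1)ᶜ)).toFinset y, q.1))) 0).2)) 0 (insA (Set.toFinite (bondsIn 0 ((s'.Λ 1)ᶜ ∩ s'.Ω 1))).toFinset q.2 ((Function.update (baseCfg 1 ((MeasurableEquiv.piEquivPiSubtypeProd (fun _ : PBond (F.P p.K) 1 => SU N)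
              (· ∈ (Set.toFinite (bondsIn 1 (s'.Ω 1)ᶜ)).toFinset)).symm (avgRestrOfRecord F N p.K 0 (Set.toFinite (bondsIn 0 (s'.Ω 1)ᶜ)).toFinset
                (Set.toFinite (bondsIn 1 (s'.Ω 1)ᶜ)).toFinset y, q.1))) 0
            (Function.updateFinset ((baseCfg (V := FluctV N) 1 ((MeasurableEquiv.piEquivPiSubtypeProd (fun _ : PBond (F.P p.K) 1 => SU N)
              (· ∈ (Set.toFinite (bondsIn 1 (s'.Ω 1)ᶜ)).toFinset)).symm (avgRestrOfRecord F N p.K 0 (Set.toFinite (bondsIn 0 (s'.Ω 1)ᶜ)).toFinset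
                (Set.toFinite (bondsIn 1 (s'.Ω 1)ᶜ)).toFinset y, q.1))) 0).1 (Set.toFinite (bondsIn 0 (s'.Ω 1)ᶜ)).toFinset y,
              ((baseCfg (V := FluctV N) 1 ((MeasurableEquiv.piEquivPiSubtypeProd (fun _ : PBond (F.P p.K) 1 => SU N)
              (· ∈ (Set.toFinite (bondsIn 1 (s'.Ω 1)ᶜ)).toFinset)).symm (avgRestrOfRecord F N p.K 0 (Set.toFinite (bondsIn 0 (s'.Ω 1)ᶜ)).toFinset
                (Set.toFinite (bondsIn 1 (s'.Ω 1)ᶜ)).toFinset y, q.1))) 0).2)) 0)))))) :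
    slotsTOfRecord F N θ.ν θ.τ9 (EOfRecord₁₃ F N θ.toStage13Params) (wOfRecord₉ F N θ.toStage9Params) θ.ppSel p (gOfRecord₁₃ F N θ.toStage13Params p) 1 s' = 0 ∨
      ∀ᵐ V' ∂fieldMeasure (F.P p.K) 1 (SU N),
        chiSeqOfRecord F N θ.ν θ.τ9.M (gOfRecord₁₃ F N θ.toStage13Params p) p.K 1 s' V' ≠ 0 →
          slotsTOfRecord F N θ.ν θ.τ9 (EOfRecord₁₃ F N θ.toStage13Params) (wOfRecord₉ F N θ.toStage9Params) θ.ppSel p (gOfRecord₁₃ F N θ.toStage13Params p) 1 s' V' =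
            sect2Slot F N (FluctV N) p.K (settingOfRecord₁₃ F N θ.toStage13Params p) (θ.rzAt p s') (WtOfRecord₁₃H F N θ p s') s' u₁ e₁
              (UbgOfRecord₁₃CoP F N θ.toStage13Params p 1 s') V' := by
  have hk : 0 + 1 ≤ (F.P p.K).m + (F.P p.K).K := by show 0 + 1 ≤ F.m + p.K; omega
  -- the graph `w(s′)·χ_0·ρ₀ = w(s′)·ρ₀` is `dU`-integrable under the core provisos
  have hG := hG_at_record₁₃_of_provisos θ h p hK s'
  have h1 : (fun U => wOfRecord₉ F N θ.toStage9Params p (gOfRecord₁₃ F N θ.toStage13Params p) 0 s' U ((avOfRecord F N p.K 0).avg U) *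
        slotsOfRecord F N θ.ν θ.τ9 (EOfRecord₁₃ F N θ.toStage13Params) (wOfRecord₉ F N θ.toStage9Params) θ.ppSel p (gOfRecord₁₃ F N θ.toStage13Params p) 0 s'.init U) =
      fun U => wOfRecord₉ F N θ.toStage9Params p (gOfRecord₁₃ F N θ.toStage13Params p) 0 s' U ((avOfRecord F N p.K 0).avg U) *
        (chiSeqOfRecord F N θ.ν θ.τ9.M (gOfRecord₁₃ F N θ.toStage13Params p) p.K 0 s'.init U *
          slotsOfRecord F N θ.ν θ.τ9 (EOfRecord₁₃ F N θ.toStage13Params) (wOfRecord₉ F N θ.toStage9Params) θ.ppSel p (gOfRecord₁₃ F N θ.toStage13Params p) 0 s'.init U) := by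
    funext U; rw [chiSeqOfRecord_zero, one_mul]
  rw [← h1] at hG
  -- the intrinsic reading at the first step is measurable and nonnegative (`admSOfRecord_zero`, `𝐓_0 = 1`)
  have hW := WtOfRecord₁₃H_laws h.zhLaws p s'
  have hmem : (fun _ => (∅ : Set (Site (F.P p.K) 0))) ∈ admSOfRecord F θ.ν θ.τ9.M (gOfRecord₁₃ F N θ.toStage13Params p) p.K 0 s'.init := by
    rw [admSOfRecord_zero, Finset.mem_singleton]
  have hRm := measurable_intrinsicReading_of_hgm θ.ν θ.τ9.M (gOfRecord₁₃ F N θ.toStage13Params p) p (hdec := hdec) (hdec' := hdec') s' (WtOfRecord₁₃H F N θ p s')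
      (sect2Operand F N (FluctV N) p.K (settingOfRecord₁₃ F N θ.toStage13Params p) (θ.rzAt p s') s' u₁ e₁
                  (UbgOfRecord₁₃CoP F N θ.toStage13Params p 1 s')) (hgm_at_record₁₃_of_rows θ p (hdec := hdec) (hdec' := hdec') s' u₁ e₁ hζm hqm' hΦm) _ hmem
  have hR0 : ∀ z : ((↥(Set.toFinite (bondsIn 0 (s'.Ω 1)ᶜ)).toFinset → SU N) × ({c : PBond (F.P p.K) 1 // c ∉ (Set.toFinite (bondsIn 1 (s'.Ω 1)ᶜ)).toFinset} → SU N)), 0 ≤ ∑ Y ∈ (Set.toFinite {Y : Set (Site (F.P p.K) 0) | Y ∈ SClassOfRecord F θ.ν (gOfRecord₁₃ F N θ.toStage13Params p) p.K 1 ∧ Y ⊆ s'.Ω 1 ∩ (s'.Λ 1)ᶜ}).toFinset,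
            zetaOp (genDataOfRecord F N (FluctV N) θ.ν θ.τ9.M (gOfRecord₁₃ F N θ.toStage13Params p) p.K (WtOfRecord₁₃H F N θ p s') s' (Function.update (fun _ => ∅) 1 Y) 0).ζ
              (aOp 0 (genDataOfRecord F N (FluctV N) θ.ν θ.τ9.M (gOfRecord₁₃ F N θ.toStage13Params p) p.K (WtOfRecord₁₃H F N θ p s') s' (Function.update (fun _ => ∅) 1 Y) 0).sA
                (genDataOfRecord F N (FluctV N) θ.ν θ.τ9.M (gOfRecord₁₃ F N θ.toStage13Params p) p.K (WtOfRecord₁₃H F N θ p s') s' (Function.update (fun _ => ∅) 1 Y) 0).w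
                (fun ω => (sect2Operand F N (FluctV N) p.K (settingOfRecord₁₃ F N θ.toStage13Params p) (θ.rzAt p s') s' u₁ e₁
                    (UbgOfRecord₁₃CoP F N θ.toStage13Params p 1 s')) (Function.update (fun _ => ∅) 1 Y, fun j => (ω j).2) (fun j => (ω j).1)))
              (Function.update (baseCfg 1 ((MeasurableEquiv.piEquivPiSubtypeProd (fun _ : PBond (F.P p.K) 1 => SU N)
                (· ∈ (Set.toFinite (bondsIn 1 (s'.Ω 1)ᶜ)).toFinset)).symm (avgRestrOfRecord F N p.K 0 (Set.toFinite (bondsIn 0 (s'.Ω 1)ᶜ)).toFinset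
                  (Set.toFinite (bondsIn 1 (s'.Ω 1)ᶜ)).toFinset z.1, z.2))) 0
              (Function.updateFinset ((baseCfg (V := FluctV N) 1 ((MeasurableEquiv.piEquivPiSubtypeProd (fun _ : PBond (F.P p.K) 1 => SU N)
                (· ∈ (Set.toFinite (bondsIn 1 (s'.Ω 1)ᶜ)).toFinset)).symm (avgRestrOfRecord F N p.K 0 (Set.toFinite (bondsIn 0 (s'.Ω 1)ᶜ)).toFinset
                  (Set.toFinite (bondsIn 1 (s'.Ω 1)ᶜ)).toFinset z.1, z.2))) 0).1 (Set.toFinite (bondsIn 0 (s'.Ω 1)ᶜ)).toFinset z.1,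
                ((baseCfg (V := FluctV N) 1 ((MeasurableEquiv.piEquivPiSubtypeProd (fun _ : PBond (F.P p.K) 1 => SU N)
                (· ∈ (Set.toFinite (bondsIn 1 (s'.Ω 1)ᶜ)).toFinset)).symm (avgRestrOfRecord F N p.K 0 (Set.toFinite (bondsIn 0 (s'.Ω 1)ᶜ)).toFinset
                  (Set.toFinite (bondsIn 1 (s'.Ω 1)ᶜ)).toFinset z.1, z.2))) 0).2)) := fun z =>
    Finset.sum_nonneg fun Y _ => by
      rw [zetaOp_apply]
      exact mul_nonneg ((genDataOfRecord_laws F N (FluctV N) θ.ν θ.τ9.M (gOfRecord₁₃ F N θ.toStage13Params p) p.K hW s' (Function.update (fun _ => ∅) 1 Y) 0).zeta_nonneg _)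
        (aOp_nonneg 0 _ (genDataOfRecord_laws F N (FluctV N) θ.ν θ.τ9.M (gOfRecord₁₃ F N θ.toStage13Params p) p.K hW s' (Function.update (fun _ => ∅) 1 Y) 0).w_nonneg
          (fun ω => (sect2Operand_pos p.K _ _ s' u₁ e₁ _ (Function.update (fun _ => ∅) 1 Y, fun j => (ω j).2) (fun j => (ω j).1)).le) _)
  -- the new weights' rows; the (only) old branch `∅`; the integrability of the piece through the glue
  have hζWm : ∀ j Y, Measurable ((WtOfRecord₁₃H F N θ p s').ζ j Y) := fun j Y =>
    measurable_tkWeightsOfRecordP_ζ F N (FluctV N) θ.ν θ.A₁ p (gOfRecord₁₃ F N θ.toStage13Params p) (θ.zhAt p s') j Y (hζm j Y)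
  have hwWm : ∀ j Λ' Y S, Measurable ((WtOfRecord₁₃H F N θ p s').w j Λ' Y S) := fun j Λ' Y S =>
    measurable_tkWeightsOfRecordP_w F N (FluctV N) θ.ν θ.A₁ p (gOfRecord₁₃ F N θ.toStage13Params p) (θ.zhAt p s') j Λ' Y S (hqm' j Λ')
  have hpres := measurePreserving_piEquivPiSubtypeProd_symm_fieldMeasure (G := SU N) (P := F.P p.K) (j := 0) (Set.toFinite (bondsIn 0 (s'.Ω 1)ᶜ)).toFinset
  have hρ' := (hpres.integrable_comp hG.aestronglyMeasurable).mpr hG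
  have hchart : ∀ᵐ y ∂(Measure.pi fun _ : ↥(Set.toFinite (bondsIn 0 (s'.Ω 1)ᶜ)).toFinset => (HaarData.haar : Measure (SU N))),
      Measurable (Ψ y) ∧ Measurable (J y) ∧
      ((((Measure.pi fun _ : {c : PBond (F.P p.K) 1 // c ∉ (Set.toFinite (bondsIn 1 (s'.Ω 1)ᶜ)).toFinset} => (HaarData.haar : Measure (SU N))) ⊗ₘ
          (fun y => Kernel.const _ ((Measure.pi fun _ : ↥(Set.toFinite (bondsIn 0 ((s'.Λ 1)ᶜ ∩ s'.Ω 1))).toFinset => (volume : Measure (FluctV N))).prod (τ y))) y).withDensity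
          (fun z => (J y z : ℝ≥0∞))).map (Ψ y) =
        (Measure.pi fun _ : {b : PBond (F.P p.K) 0 // b ∉ (Set.toFinite (bondsIn 0 (s'.Ω 1)ᶜ)).toFinset} => (HaarData.haar : Measure (SU N))).restrict (Sc y)) ∧
      (∀ᵐ z ∂(((Measure.pi fun _ : {c : PBond (F.P p.K) 1 // c ∉ (Set.toFinite (bondsIn 1 (s'.Ω 1)ᶜ)).toFinset} => (HaarData.haar : Measure (SU N))) ⊗ₘ
          (fun y => Kernel.const _ ((Measure.pi fun _ : ↥(Set.toFinite (bondsIn 0 ((s'.Λ 1)ᶜ ∩ s'.Ω 1))).toFinset => (volume : Measure (FluctV N))).prod (τ y))) y).withDensity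
          (fun z => (J y z : ℝ≥0∞))),
        (fun c : {c : PBond (F.P p.K) 1 // c ∉ (Set.toFinite (bondsIn 1 (s'.Ω 1)ᶜ)).toFinset} =>
          (avOfRecord F N p.K 0).avg ((MeasurableEquiv.piEquivPiSubtypeProd (fun _ : PBond (F.P p.K) 0 => SU N)
              (· ∈ (Set.toFinite (bondsIn 0 (s'.Ω 1)ᶜ)).toFinset)).symm (y, Ψ y z)) c) = z.1) ∧
      (∀ u, u ∉ Sc y → (fun U => wOfRecord₉ F N θ.toStage9Params p (gOfRecord₁₃ F N θ.toStage13Params p) 0 s' U ((avOfRecord F N p.K 0).avg U) *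
            slotsOfRecord F N θ.ν θ.τ9 (EOfRecord₁₃ F N θ.toStage13Params) (wOfRecord₉ F N θ.toStage9Params) θ.ppSel p (gOfRecord₁₃ F N θ.toStage13Params p) 0 s'.init U)
          ((MeasurableEquiv.piEquivPiSubtypeProd (fun _ : PBond (F.P p.K) 0 => SU N)
              (· ∈ (Set.toFinite (bondsIn 0 (s'.Ω 1)ᶜ)).toFinset)).symm (y, u)) = 0) ∧
      ((fun v => ∫ x, (J y (v, x) : ℝ) * (fun U => wOfRecord₉ F N θ.toStage9Params p (gOfRecord₁₃ F N θ.toStage13Params p) 0 s' U ((avOfRecord F N p.K 0).avg U) *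
            slotsOfRecord F N θ.ν θ.τ9 (EOfRecord₁₃ F N θ.toStage13Params) (wOfRecord₉ F N θ.toStage9Params) θ.ppSel p (gOfRecord₁₃ F N θ.toStage13Params p) 0 s'.init U)
          ((MeasurableEquiv.piEquivPiSubtypeProd (fun _ : PBond (F.P p.K) 0 => SU N)
              (· ∈ (Set.toFinite (bondsIn 0 (s'.Ω 1)ᶜ)).toFinset)).symm (y, Ψ y (v, x))) ∂((fun y => Kernel.const _ ((Measure.pi fun _ : ↥(Set.toFinite (bondsIn 0 ((s'.Λ 1)ᶜ ∩ s'.Ω 1))).toFinset => (volume : Measure (FluctV N))).prod (τ y))) y v))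
        =ᵐ[(Measure.pi fun _ : {c : PBond (F.P p.K) 1 // c ∉ (Set.toFinite (bondsIn 1 (s'.Ω 1)ᶜ)).toFinset} => (HaarData.haar : Measure (SU N)))] fun v => ∑ Y ∈ (Set.toFinite {Y : Set (Site (F.P p.K) 0) | Y ∈ SClassOfRecord F θ.ν (gOfRecord₁₃ F N θ.toStage13Params p) p.K 1 ∧ Y ⊆ s'.Ω 1 ∩ (s'.Λ 1)ᶜ}).toFinset,
          zetaOp (genDataOfRecord F N (FluctV N) θ.ν θ.τ9.M (gOfRecord₁₃ F N θ.toStage13Params p) p.K (WtOfRecord₁₃H F N θ p s') s' (Function.update (fun _ => ∅) 1 Y) 0).ζ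
            (aOp 0 (genDataOfRecord F N (FluctV N) θ.ν θ.τ9.M (gOfRecord₁₃ F N θ.toStage13Params p) p.K (WtOfRecord₁₃H F N θ p s') s' (Function.update (fun _ => ∅) 1 Y) 0).sA
              (genDataOfRecord F N (FluctV N) θ.ν θ.τ9.M (gOfRecord₁₃ F N θ.toStage13Params p) p.K (WtOfRecord₁₃H F N θ p s') s' (Function.update (fun _ => ∅) 1 Y) 0).w
              (fun ω => (sect2Operand F N (FluctV N) p.K (settingOfRecord₁₃ F N θ.toStage13Params p) (θ.rzAt p s') s' u₁ e₁
                  (UbgOfRecord₁₃CoP F N θ.toStage13Params p 1 s')) (Function.update (fun _ => ∅) 1 Y, fun j => (ω j).2) (fun j => (ω j).1)))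
            (Function.update (baseCfg 1 ((MeasurableEquiv.piEquivPiSubtypeProd (fun _ : PBond (F.P p.K) 1 => SU N)
              (· ∈ (Set.toFinite (bondsIn 1 (s'.Ω 1)ᶜ)).toFinset)).symm (avgRestrOfRecord F N p.K 0 (Set.toFinite (bondsIn 0 (s'.Ω 1)ᶜ)).toFinset
                (Set.toFinite (bondsIn 1 (s'.Ω 1)ᶜ)).toFinset y, v))) 0
            (Function.updateFinset ((baseCfg (V := FluctV N) 1 ((MeasurableEquiv.piEquivPiSubtypeProd (fun _ : PBond (F.P p.K) 1 => SU N)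
              (· ∈ (Set.toFinite (bondsIn 1 (s'.Ω 1)ᶜ)).toFinset)).symm (avgRestrOfRecord F N p.K 0 (Set.toFinite (bondsIn 0 (s'.Ω 1)ᶜ)).toFinset
                (Set.toFinite (bondsIn 1 (s'.Ω 1)ᶜ)).toFinset y, v))) 0).1 (Set.toFinite (bondsIn 0 (s'.Ω 1)ᶜ)).toFinset y,
              ((baseCfg (V := FluctV N) 1 ((MeasurableEquiv.piEquivPiSubtypeProd (fun _ : PBond (F.P p.K) 1 => SU N)
              (· ∈ (Set.toFinite (bondsIn 1 (s'.Ω 1)ᶜ)).toFinset)).symm (avgRestrOfRecord F N p.K 0 (Set.toFinite (bondsIn 0 (s'.Ω 1)ᶜ)).toFinset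
                (Set.toFinite (bondsIn 1 (s'.Ω 1)ᶜ)).toFinset y, v))) 0).2))) := by
    filter_upwards [hsplit, hρ'.prod_right_ae] with y ⟨hΨ, hJ, hpush, hsec, hρS, hpt⟩ hρy
    refine ⟨hΨ, hJ, ?_, ?_, hρS, ?_⟩
    · rw [Measure.compProd_const]; exact hpush
    · rw [Measure.compProd_const]; exact hsec
    · simp only [Kernel.const_apply]
      exact reading_of_keptSplit_at_record θ.ν θ.τ9.M (gOfRecord₁₃ F N θ.toStage13Params p) p (hdec := hdec) (hdec' := hdec') s' hW hζWm hwWm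
        (fun 𝔞 U => sect2Operand F N (FluctV N) p.K (settingOfRecord₁₃ F N θ.toStage13Params p) (θ.rzAt p s') s' u₁ e₁
          (UbgOfRecord₁₃CoP F N θ.toStage13Params p 1 s') 𝔞 U)
        (fun 𝔞 U => (sect2Operand_pos p.K _ _ s' u₁ e₁ _ 𝔞 U).le) hΦm (fun _ => ∅) hmem y (τ y) hρy hΨ hJ hpush hpt
  exact slotsTOfRecord₁₃H_one_O3_of_condExpRho_of_provisos θ h p hK (hdec := hdec) (hdec' := hdec') s' u₁ e₁ hζ0m hqm hζm hqm' hΦm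
    (condExp_identity_of_fibreCharts_of_nonneg θ.ν θ.τ9.M (gOfRecord₁₃ F N θ.toStage13Params p) p (hdec := hdec) (hdec' := hdec') hk s' hG
      (fun y => Kernel.const _ ((Measure.pi fun _ : ↥(Set.toFinite (bondsIn 0 ((s'.Λ 1)ᶜ ∩ s'.Ω 1))).toFinset => (volume : Measure (FluctV N))).prod (τ y)))
      (hκ := fun y => inferInstance) Ψ J Sc hchart hR0 hRm)

end FirstStep

end Summit.QuantumFields.YangMills.Theorems.BalabanUVNodesN11FirstTStepO3OfSplitCharts

end
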